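import Summits.QuantumFields.YangMills.Theorems.SwapVirialDeficitSectorLaplaceDefs
import Summits.QuantumFields.YangMills.Theorems.SwapVirialDeficitBlowUpGnomonicFibreHessianPackage
import Summits.QuantumFields.YangMills.Theorems.SwapVirialDeficitQuantitativeLaplaceGaussianFloor
import HarnessLib

/-!
# (S)-road: POINTWISE facts on the Morse–Bott density `𝔪(a,ε,p)` of sector 000 in fcl-p3 g47's letters (✓`SectorLaplaceDefs`: `fibQ`, `mbDensity`, `alpha`)
# — the fixed-hub half of stub S3 and LEAD g97's S4b model half at every base point
# (free-hands support of ⟨stmt-QuantumFields-24197⟩ `SwapVirialDeficit.SwapGluedStiffness` ∕ ⟨24194⟩)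

* §1 the fibre form: `abs_fibQ_le` (`|Q| ≤ 20400L⁴‖y‖²`, every hub `a ≠ 0` and base point — ✓`fibre_lineJets`), ★ `fibQ_coercive_explicit` (`λ(a,p)‖y‖² ≤ Q` with w3 g66's
  EXPLICIT `λ = min(min(2s₂ψ²/((2+x₀²)16200L⁶), 2sψ²/((2+y₀²)16200L⁶)), min(1/16200L⁶, (2304L⁶|Fol L|)⁻¹/2)) > 0` for `re a ≠ 0`, `im a ≠ 0`, good signs —
  ✓`fibre_raySecond_coercive_gnomonic_explicit`), `lam_explicit_pos`, `measurable_fibQ_prod` (`(p, y) ↦ Q` jointly measurable at fixed hub — ✓`exists_gnoFibreHessian`),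
  `measurable_fibQ`, `integrable_exp_neg_fibQ_half` (✓`gaussian_floor_of_le`);
* §2 the density: `mbDensity_nonneg` (always), ★★ `mbDensity_ge` — `ρ(gnoBase p)·(20400L⁴)^{−α} ≤ 𝔪(a,ε,p)` for `re a ≠ 0`, `im a ≠ 0`, good signs, EVERY `p` (LEAD memo4 §1
  S4b model half, pointwise; ✓`normalised_gaussian_floor_of_le`), ★ `measurable_mbDensity_base` (`p ↦ 𝔪(a,ε,p)` measurable at fixed hub `a ≠ 0`,
  ✓`StronglyMeasurable.integral_prod_right'`).

What is NOT here: JOINT measurability ∕ integrability in the hub `a` (S3 proper: w3 g66's ✓`measurable_iteratedDeriv_two_param` + model instance, then Fubini), the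
floor of `mbConst` itself (needs S3's integrability — else the Bochner double integral is junk — plus `coneMeasure(HubBulk ½) > 0` and the `K_L` floor: g47∕LEAD), S4∕S5.
HONEST LABEL: pointwise bookkeeping; ⟨24197⟩ ∕ ⟨24194⟩ (window-uniform) OPEN; own crux ⟨22884⟩ OPEN (blocked-on ⟨19935⟩); no crux, rung of record or summit is proved; the
Yang–Mills mass gap is NOT proved; no summit is proved by a line.  Width seat ym-line-sfw-p2-w2 g59 (cell ym-idea-1, free hands), `--supports stmt-QuantumFields-24197`.
THEOREMS ONLY (0 `def`, 0 `sorry`), standard axioms.  References: [cite: Luscher1983, §2]; [cite: Breitung1994, Lemma 39 p. 55]; [folklore].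
-/

set_option autoImplicit false
set_option synthInstance.maxSize 1024

noncomputable section

open MeasureTheory Quaternion Set Module
open scoped Quaternion BigOperators ENNReal InnerProductSpace
open Literature.MathematicalPhysics.QuantumLattice
open Literature.MathematicalPhysics.QuantumFieldTheory hiding SU2

namespace Summit.QuantumFields.YangMills.Theorems.SwapVirialDeficit.SectorLaplace

open Summit.QuantumFields.YangMills.Theorems.FemtoTransferGap
open Summit.QuantumFields.YangMills.Theorems.FemtoTransferGap.TT
open Summit.QuantumFields.YangMills.Theorems.VirialFluxGap.RingDeficit
open Summit.QuantumFields.YangMills.Theorems.SwapVirialDeficit.SwapRing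
open Summit.QuantumFields.YangMills.Theorems.SwapVirialDeficit.BlowUpRing
open Summit.QuantumFields.YangMills.Theorems.SwapVirialDeficit.Gnomonic (normSq3)
open Summit.QuantumFields.YangMills.Theorems.QuantitativeLaplace (gaussian_floor_of_le normalised_gaussian_floor_of_le)

variable {L : ℕ} [NeZero L]

/-! ## §1 The fibre form `Q_{a,ε,p}` -/

/-- `|Q_{a,ε,p}(y)| ≤ 20400L⁴‖y‖²` for every hub `a ≠ 0`, signs and base point (✓`fibre_lineJets`, second jet at `s = 0`). [cite: Luscher1983, §2] -/
theorem abs_fibQ_le {a : ℍ} (ha : a ≠ 0) (ε : GnoSign L) (p : ℝ × ℝ) (y : GnoFibre L) : |fibQ a ε p y| ≤ 20400 * (L : ℝ) ^ 4 * ‖y‖ ^ 2 :=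
  ((fibre_lineJets z₀ (fun _ => 1) ha ε (gnoBase p.1 p.2) y).1 0).2.1

/-- ★ **COERCIVITY OF `Q` WITH w3 g66's EXPLICIT CONSTANT**: for `re a ≠ 0`, `im a ≠ 0`, good signs and every base point `p`, `λ(a,p)·‖y‖² ≤ Q_{a,ε,p}(y)`.
[cite: Luscher1983, §2] -/
theorem fibQ_coercive_explicit {a : ℍ} (hre : a.re ≠ 0) (him : a.im ≠ 0) {ε : GnoSign L} (hε : GoodSign ε) (p : ℝ × ℝ) (y : GnoFibre L) :
    min (min (2 * (2 * (‖a‖⁻¹ * a.re) * (‖a‖⁻¹ * ‖a.im‖)) ^ 2 / ((2 + p.1 ^ 2) * (16200 * (L : ℝ) ^ 6)))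
        (2 * (‖a‖⁻¹ * ‖a.im‖) ^ 2 / ((2 + p.2 ^ 2) * (16200 * (L : ℝ) ^ 6))))
      (min (1 / (16200 * (L : ℝ) ^ 6)) ((2304 * (L : ℝ) ^ 6 * (Fintype.card (Fol L) : ℝ))⁻¹ / 2)) * ‖y‖ ^ 2 ≤ fibQ a ε p y := by
  unfold fibQ
  rw [norm_sq_gnoFibre, gnoFibreEmb_eq_fibreDir]
  exact fibre_raySecond_coercive_gnomonic_explicit hre him ε hε.1 hε.2 p.1 p.2 (gnoFibreBlocks y)

/-- w3 g66's explicit constant is positive for `re a ≠ 0`, `im a ≠ 0`. [folklore] -/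
theorem lam_explicit_pos {a : ℍ} (hre : a.re ≠ 0) (him : a.im ≠ 0) (p : ℝ × ℝ) :
    0 < min (min (2 * (2 * (‖a‖⁻¹ * a.re) * (‖a‖⁻¹ * ‖a.im‖)) ^ 2 / ((2 + p.1 ^ 2) * (16200 * (L : ℝ) ^ 6)))
        (2 * (‖a‖⁻¹ * ‖a.im‖) ^ 2 / ((2 + p.2 ^ 2) * (16200 * (L : ℝ) ^ 6))))
      (min (1 / (16200 * (L : ℝ) ^ 6)) ((2304 * (L : ℝ) ^ 6 * (Fintype.card (Fol L) : ℝ))⁻¹ / 2)) := by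
  have ha : a ≠ 0 := fun h => hre (by rw [h]; rfl)
  have hL : (0 : ℝ) < (L : ℝ) := Nat.cast_pos.2 (Nat.pos_of_ne_zero (NeZero.ne L))
  have hna : 0 < ‖a‖ := norm_pos_iff.2 ha
  have hni : 0 < ‖a.im‖ := norm_pos_iff.2 him
  have hcard : 0 < (Fintype.card (Fol L) : ℝ) := by
    have h : 0 < Fintype.card (Fol L) := by rw [card_fol]; have := Nat.one_le_pow 4 L NeZero.one_le; omega
    exact_mod_cast h
  have hs : 0 < ‖a‖⁻¹ * ‖a.im‖ := mul_pos (inv_pos.2 hna) hni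
  have h2 : 0 < (2 * (‖a‖⁻¹ * a.re) * (‖a‖⁻¹ * ‖a.im‖)) ^ 2 := by
    have h1 : 2 * (‖a‖⁻¹ * a.re) * (‖a‖⁻¹ * ‖a.im‖) ≠ 0 :=
      mul_ne_zero (mul_ne_zero two_ne_zero (mul_ne_zero (inv_ne_zero hna.ne') hre)) hs.ne'
    positivity
  refine lt_min (lt_min (by positivity) (by positivity)) (lt_min (by positivity) (by positivity))

/-- ★ `(p, y) ↦ Q_{a,ε,p}(y)` is jointly measurable at a fixed hub `a ≠ 0` (through the Hessian operators of ✓`exists_gnoFibreHessian`). [folklore] -/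
theorem measurable_fibQ_prod {a : ℍ} (ha : a ≠ 0) (ε : GnoSign L) : Measurable fun q : (ℝ × ℝ) × GnoFibre L => fibQ a ε q.1 q.2 := by
  obtain ⟨A, -, -, -, hray, hAm, -, -⟩ := exists_gnoFibreHessian z₀ (fun _ => 1) ha ε
  -- the base point as a measurable function of `p` (through the measurable chart)
  have hbase : Measurable fun p : ℝ × ℝ => (gnoBase p.1 p.2 : GnoCoord L) := by
    have h := (measurable_gnoFibreEquiv (L := L)).comp (measurable_id.prodMk (measurable_const (a := (0 : GnoFibre L))))
    have e : (fun p : ℝ × ℝ => (gnoBase p.1 p.2 : GnoCoord L)) = fun p => gnoFibreEquiv (p, (0 : GnoFibre L)) :=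
      funext fun p => by rw [gnoFibreEquiv_apply, map_zero, add_zero]
    rw [e]; exact h
  have hG : Measurable fun q : (ℝ × ℝ) × GnoFibre L => ((gnoBase q.1.1 q.1.2 : GnoCoord L), q.2) := (hbase.comp measurable_fst).prodMk measurable_snd
  have hAbm : Measurable fun q : (ℝ × ℝ) × GnoFibre L => ⟪A (gnoBase q.1.1 q.1.2) q.2, q.2⟫_ℝ := by
    have h := Measurable.comp hAm hG
    exact h
  have e : (fun q : (ℝ × ℝ) × GnoFibre L => fibQ a ε q.1 q.2) = fun q => ⟪A (gnoBase q.1.1 q.1.2) q.2, q.2⟫_ℝ :=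
    funext fun q => (hray _ _).symm
  rw [e]; exact hAbm

/-- `y ↦ Q_{a,ε,p}(y)` is measurable at fixed hub `a ≠ 0` and base point. [folklore] -/
theorem measurable_fibQ {a : ℍ} (ha : a ≠ 0) (ε : GnoSign L) (p : ℝ × ℝ) : Measurable fun y : GnoFibre L => fibQ a ε p y := by
  -- (composition elaborated WITHOUT the expected type: `….comp …` against the target makes `whnf` time out)
  have hpy : Measurable fun y : GnoFibre L => (p, y) := measurable_const.prodMk measurable_id
  have h := Measurable.comp (measurable_fibQ_prod ha ε) hpy
  exact h

/-- ★ `y ↦ e^{−Q/2}` is integrable on the fibre, for `re a ≠ 0`, `im a ≠ 0`, good signs (✓`gaussian_floor_of_le`). [cite: Breitung1994, Lemma 39 p. 55] -/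
theorem integrable_exp_neg_fibQ_half {a : ℍ} (hre : a.re ≠ 0) (him : a.im ≠ 0) {ε : GnoSign L} (hε : GoodSign ε) (p : ℝ × ℝ) :
    Integrable fun y : GnoFibre L => Real.exp (-(fibQ a ε p y / 2)) := by
  have ha : a ≠ 0 := fun h => hre (by rw [h]; rfl)
  have hL : (0 : ℝ) < (L : ℝ) := Nat.cast_pos.2 (Nat.pos_of_ne_zero (NeZero.ne L))
  exact (gaussian_floor_of_le (measurable_fibQ ha ε p) (lam_explicit_pos hre him p) (by positivity : (0 : ℝ) < 20400 * (L : ℝ) ^ 4)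
    (fibQ_coercive_explicit hre him hε p) (fun y => (abs_le.1 (abs_fibQ_le ha ε p y)).2)).1

/-! ## §2 The density `𝔪(a,ε,p)` -/

/-- `0 ≤ 𝔪(a,ε,p)` always (density, normalisation and a non-negative integrand; Bochner junk is `0`). [folklore] -/
theorem mbDensity_nonneg (a : ℍ) (ε : GnoSign L) (p : ℝ × ℝ) : 0 ≤ mbDensity (L := L) a ε p := by
  unfold mbDensity
  exact mul_nonneg (mul_nonneg (gnoDensity_pos _).le (inv_nonneg.2 (Real.rpow_nonneg (by positivity) _))) (integral_nonneg fun y => (Real.exp_pos _).le)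

/-- ★★ **THE MODEL HALF OF S4b, POINTWISE**: for `re a ≠ 0`, `im a ≠ 0`, good signs and EVERY base point `p`,
`ρ(gnoBase p)·(20400L⁴)^{−α} ≤ 𝔪(a,ε,p)` (`α = dim V_L/2 = 9L⁴ − 1`; ✓`normalised_gaussian_floor_of_le` with `Λ = 20400L⁴` from ✓`abs_fibQ_le` and `λ = λ(a,p) > 0` from
✓`fibQ_coercive_explicit`). [cite: Breitung1994, Lemma 39 p. 55] -/
theorem mbDensity_ge {a : ℍ} (hre : a.re ≠ 0) (him : a.im ≠ 0) {ε : GnoSign L} (hε : GoodSign ε) (p : ℝ × ℝ) :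
    gnoDensity (gnoBase p.1 p.2 : GnoCoord L) * (20400 * (L : ℝ) ^ 4) ^ (-alpha L) ≤ mbDensity (L := L) a ε p := by
  have ha : a ≠ 0 := fun h => hre (by rw [h]; rfl)
  have hL : (0 : ℝ) < (L : ℝ) := Nat.cast_pos.2 (Nat.pos_of_ne_zero (NeZero.ne L))
  have h := normalised_gaussian_floor_of_le (measurable_fibQ ha ε p) (lam_explicit_pos hre him p) (by positivity : (0 : ℝ) < 20400 * (L : ℝ) ^ 4)
    (fibQ_coercive_explicit hre him hε p) (fun y => (abs_le.1 (abs_fibQ_le ha ε p y)).2)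
  unfold mbDensity alpha
  rw [mul_assoc]
  exact mul_le_mul_of_nonneg_left h (gnoDensity_pos _).le

/-- ★ `p ↦ 𝔪(a,ε,p)` is measurable at a fixed hub `a ≠ 0` (the fibre integral of a jointly measurable function, ✓`StronglyMeasurable.integral_prod_right'`). [folklore] -/
theorem measurable_mbDensity_base {a : ℍ} (ha : a ≠ 0) (ε : GnoSign L) : Measurable fun p : ℝ × ℝ => mbDensity (L := L) a ε p := by
  have hF : StronglyMeasurable fun q : (ℝ × ℝ) × GnoFibre L => Real.exp (-(fibQ a ε q.1 q.2 / 2)) :=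
    (Real.measurable_exp.comp ((measurable_fibQ_prod ha ε).div_const 2).neg).stronglyMeasurable
  have hI : Measurable fun p : ℝ × ℝ => ∫ y : GnoFibre L, Real.exp (-(fibQ a ε p y / 2)) := (hF.integral_prod_right' (ν := volume)).measurable
  have hρ : Measurable fun p : ℝ × ℝ => gnoDensity (gnoBase p.1 p.2 : GnoCoord L) := (gnoDensity_gnoBase_pos_continuous (L := L)).2.measurable
  unfold mbDensity
  exact (hρ.mul measurable_const).mul hI

/-- The fibre factor alone is at most `λ(a,p)^{−α}`-free… — not needed; instead the trivial UPPER bound `𝔪 ≤ ρ(gnoBase p)·(2π)^{−α}·∫e^{−Q/2}` is the definition.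
Here: `𝔪(a,ε,p)` is strictly positive for `re a ≠ 0`, `im a ≠ 0`, good signs. [folklore] -/
theorem mbDensity_pos {a : ℍ} (hre : a.re ≠ 0) (him : a.im ≠ 0) {ε : GnoSign L} (hε : GoodSign ε) (p : ℝ × ℝ) : 0 < mbDensity (L := L) a ε p := by
  have hL : (0 : ℝ) < (L : ℝ) := Nat.cast_pos.2 (Nat.pos_of_ne_zero (NeZero.ne L))
  have h := mbDensity_ge (L := L) hre him hε p
  exact lt_of_lt_of_le (mul_pos (gnoDensity_pos _) (Real.rpow_pos_of_pos (by positivity) _)) h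

end Summit.QuantumFields.YangMills.Theorems.SwapVirialDeficit.SectorLaplace

end
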